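import Literature.Barriers.Parity.SmallScalePatternsWalk
import HarnessLib

/-!
# Small-scale irregularity of linear patterns of primes: endgame inequalities

Proof companion (part 3 of 4) of `Literature/Barriers/Parity/SmallScalePatterns.lean`
(Pandey–Woo 2024, Theorem 5; the case `t = 1`, assembled in
`SmallScalePatternsProofs.lean`). Everything here is PROVED and elementary:

* asymptotics in `L = log N` (`eventually_mul_rpow_le_rpow_sub`,
  `eventually_mul_rpow_add_le_exp`, `eventually_one_add_inv_rpow_pow_le`);
* the two endgames `surplus_endgame`, `deficit_endgame` — the pure inequalities turning Maier's
  row bounds, the window-shift error `c₀H` and the lattice count `(⌊H⌋+1)^d` into the constants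
  `1 + η/8` and `1 − η/16`;
* `corner_geometry` — the integer bookkeeping showing that the boxes built on the surplus row
  `m ∈ (N, 2N]` and on the deficit row `m' ∈ (N', 2N']` at the ADAPTED scale `N' = ⌊7m/10⌋` have
  all their corners in one range `[X, 2X]`, `X = min(q, q') − E`;
* `irregularity_obstructed` — the degenerate case of a single form all of whose coefficients are
  divisible by a prime (`∏_p β_p = 0`, no prime values at all).
[cite: PandeyWoo2024, Theorem 5 and §2.4]
-/

noncomputable section

open Filter Finset Topology

namespace Literature.Barriers.Parity

open Literature.NumberTheory.Sieve Literature.Barriers.Parity.Maier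

namespace SingleForm

variable {d : ℕ}

/-! ## Elementary asymptotics in `L = log N` -/

/-- Pull an eventual statement back along `L ↦ L − C`. [folklore] -/
theorem eventually_sub_const {P : ℝ → Prop} (h : ∀ᶠ y : ℝ in atTop, P y) (C : ℝ) :
    ∀ᶠ L : ℝ in atTop, P (L - C) := by
  have ht : Tendsto (fun L : ℝ => L - C) atTop atTop := tendsto_atTop_add_const_right _ _ tendsto_id
  exact ht.eventually h

/-- For `B < A`, `a, b ≥ 0`, `K ≥ 0`, `κ > 0`: eventually `K (L + a)^B ≤ κ ((L − b)^A − 1)`.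
[folklore] -/
theorem eventually_mul_rpow_le_rpow_sub {K a b A B κ : ℝ} (hK : 0 ≤ K) (ha : 0 ≤ a) (hb : 0 ≤ b)
    (hBA : B < A) (hA : 0 < A) (hκ : 0 < κ) :
    ∀ᶠ L : ℝ in atTop, K * (L + a) ^ B ≤ κ * ((L - b) ^ A - 1) := by
  have h1 : ∀ᶠ L : ℝ in atTop, (L + a) ^ B ≤ 2 * L ^ B := eventually_add_rpow_le ha one_lt_two
  have h2 : ∀ᶠ L : ℝ in atTop, (2 * K) * L ^ B ≤ (κ / 8) * L ^ A :=
    eventually_const_mul_rpow_le hBA (by positivity)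
  have h3 : ∀ᶠ L : ℝ in atTop, (L - b + b) ^ A ≤ 2 * (L - b) ^ A :=
    eventually_sub_const (eventually_add_rpow_le hb one_lt_two) b
  have h4 : ∀ᶠ L : ℝ in atTop, 4 ≤ (L - b) ^ A :=
    eventually_sub_const ((tendsto_rpow_atTop hA).eventually_ge_atTop 4) b
  filter_upwards [h1, h2, h3, h4] with L h1 h2 h3 h4
  rw [sub_add_cancel] at h3
  calc K * (L + a) ^ B ≤ K * (2 * L ^ B) := mul_le_mul_of_nonneg_left h1 hK
    _ = (2 * K) * L ^ B := by ring
    _ ≤ (κ / 8) * L ^ A := h2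
    _ ≤ (κ / 8) * (2 * (L - b) ^ A) := mul_le_mul_of_nonneg_left h3 (by positivity)
    _ ≤ κ * ((L - b) ^ A - 1) := by nlinarith

/-- For `A > 0`, `a ≥ 0`, `K ≥ 0` and any `K'`: eventually `K (L + a)^A + K' ≤ e^L`. [folklore] -/
theorem eventually_mul_rpow_add_le_exp {K K' a A : ℝ} (hK : 0 ≤ K) (ha : 0 ≤ a) (hA : 0 < A) : ∀ᶠ L : ℝ in atTop, K * (L + a) ^ A + K' ≤ Real.exp L := by
  have h1 : ∀ᶠ L : ℝ in atTop, (L + a) ^ A ≤ 2 * L ^ A := eventually_add_rpow_le ha one_lt_two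
  have h2 : ∀ᶠ L : ℝ in atTop, 2 * K + 1 ≤ Real.exp L / L ^ A :=
    (tendsto_exp_div_rpow_atTop A).eventually_ge_atTop _
  have h3 : ∀ᶠ L : ℝ in atTop, K' ≤ L ^ A := (tendsto_rpow_atTop hA).eventually_ge_atTop _
  filter_upwards [h1, h2, h3, eventually_gt_atTop 0] with L h1 h2 h3 hL
  have hLA : 0 < L ^ A := Real.rpow_pos_of_pos hL A
  rw [le_div_iff₀ hLA] at h2
  nlinarith

/-- For `λ > 0`, `κ > 1` and any `C`, `d`: eventually `(1 + 1/(L − C)^λ)^d ≤ κ`. [folklore] -/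
theorem eventually_one_add_inv_rpow_pow_le {lam C κ : ℝ} (hlam : 0 < lam) (hκ : 1 < κ) (d : ℕ) :
    ∀ᶠ L : ℝ in atTop, (1 + 1 / (L - C) ^ lam) ^ d ≤ κ := by
  have h1 : Tendsto (fun y : ℝ => (1 + 1 / y ^ lam) ^ (d : ℝ)) atTop (𝓝 1) :=
    (tendsto_one_add_div_rpow 1 d).comp (tendsto_rpow_atTop hlam)
  have h2 : ∀ᶠ y : ℝ in atTop, (1 + 1 / y ^ lam) ^ (d : ℝ) ≤ κ := h1.eventually_le_const hκ
  filter_upwards [eventually_sub_const h2 C] with L hL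
  rwa [Real.rpow_natCast] at hL

/-! ## The two endgames (pure inequalities) -/

/-- **Surplus endgame.** From Maier's row bound `R ≥ h(1 + η/4)/log 3N`, the comparison
`log 3N ≤ ℓ + C₂` with `20 C₂ ≤ η ℓ`, the smallness `20 c₀ H' ℓ ≤ η h` of the shift error and
the box bound `(H'+1)^d (R − c₀H') ≤ h · cnt` (with `H^d ≤ (H'+1)^d`), conclude
`cnt ≥ (1 + η/8) H^d/ℓ`. [folklore] -/
theorem surplus_endgame {η c₀ C₂ ℓ Lg h R Hd Hd1 H' cnt : ℝ} (hη0 : 0 < η) (hη1 : η ≤ 1)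
    (hℓ : 0 < ℓ) (hh : 0 < h) (hHd : 0 ≤ Hd) (hHd1 : Hd ≤ Hd1) (hC₂ : 0 ≤ C₂) (hLg : 0 < Lg)
    (hLgℓ : Lg ≤ ℓ + C₂) (hR : h * (1 + η / 4) / Lg ≤ R) (hA1 : 20 * C₂ ≤ η * ℓ)
    (hA2 : 20 * (c₀ * H') * ℓ ≤ η * h)
    (hcnt : Hd1 * (R - c₀ * H') ≤ h * cnt) :
    (1 + η / 8) * (Hd / ℓ) ≤ cnt := by
  -- `R/h ≥ (1+η/4)(1-η/20)/ℓ`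
  have h1 : (1 + η / 4) * (1 - η / 20) / ℓ ≤ (1 + η / 4) / Lg := by
    rw [div_le_div_iff₀ hℓ hLg]
    have : (1 - η / 20) * Lg ≤ ℓ := by nlinarith
    nlinarith
  have hRh : (1 + η / 4) * (1 - η / 20) / ℓ ≤ R / h := by
    rw [le_div_iff₀ hh]
    calc (1 + η / 4) * (1 - η / 20) / ℓ * h ≤ (1 + η / 4) / Lg * h :=
          mul_le_mul_of_nonneg_right h1 hh.le
      _ = h * (1 + η / 4) / Lg := by ring
      _ ≤ R := hR
  -- `c₀H'/h ≤ (η/20)/ℓ`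
  have hsh : c₀ * H' / h ≤ η / 20 / ℓ := by
    rw [div_le_div_iff₀ hh hℓ]; nlinarith
  -- `(R - c₀H')/h ≥ (1+η/8)/ℓ > 0`
  have hkey : (1 + η / 8) / ℓ ≤ (R - c₀ * H') / h := by
    have : (1 + η / 8) / ℓ ≤ (1 + η / 4) * (1 - η / 20) / ℓ - η / 20 / ℓ := by
      rw [← sub_div, div_le_div_iff_of_pos_right hℓ]; nlinarith
    rw [sub_div]
    linarith
  have hpos : 0 ≤ R - c₀ * H' := by
    have : 0 < (1 + η / 8) / ℓ := by positivity
    have := this.trans_le hkey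
    rw [lt_div_iff₀ hh, zero_mul] at this
    exact this.le
  have h2 : Hd * (R - c₀ * H') ≤ h * cnt := (mul_le_mul_of_nonneg_right hHd1 hpos).trans hcnt
  calc (1 + η / 8) * (Hd / ℓ) = Hd * ((1 + η / 8) / ℓ) := by ring
    _ ≤ Hd * ((R - c₀ * H') / h) := mul_le_mul_of_nonneg_left hkey hHd
    _ = Hd * (R - c₀ * H') / h := by ring
    _ ≤ cnt := by rw [div_le_iff₀ hh]; linarith

/-- **Deficit endgame.** From Maier's row bound `R ≤ h(1 − η/4)/log N'`, the comparison
`log N' ≥ ℓ − lg₃ > 0` with `20 lg₃ ≤ η(ℓ − lg₃)`, the smallness `20 c₀ H ℓ ≤ η h`, the lattice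
count `(H'+1)^d ≤ (1 + η/20) H^d` and the box bound `h · cnt ≤ (H'+1)^d (R + c₀ H)`, conclude
`cnt ≤ (1 − η/16) H^d/ℓ`. [folklore] -/
theorem deficit_endgame {η c₀ lg ℓ L' h R Hd HdP H cnt : ℝ} (hη0 : 0 < η) (hη1 : η ≤ 1)
    (hh : 0 < h) (hHd : 0 ≤ Hd) (hHdP : HdP ≤ (1 + η / 20) * Hd)
    (hlg : 0 ≤ lg) (hℓlg : lg < ℓ) (hL' : ℓ - lg ≤ L') (hR0 : 0 ≤ R)
    (hR : R ≤ h * (1 - η / 4) / L') (hA3 : 20 * lg ≤ η * (ℓ - lg)) (hH : 0 ≤ c₀ * H)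
    (hA4 : 20 * (c₀ * H) * ℓ ≤ η * h) (hcnt : h * cnt ≤ HdP * (R + c₀ * H)) :
    cnt ≤ (1 - η / 16) * (Hd / ℓ) := by
  have hℓ : 0 < ℓ := by linarith
  have hL'0 : 0 < L' := by linarith
  -- `R/h ≤ (1-η/4)(1+η/20)/ℓ`
  have h1 : (1 - η / 4) / L' ≤ (1 - η / 4) * (1 + η / 20) / ℓ := by
    rw [div_le_div_iff₀ hL'0 hℓ]
    have h14 : 0 ≤ 1 - η / 4 := by linarith
    have : ℓ ≤ (1 + η / 20) * (ℓ - lg) := by nlinarith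
    have : ℓ ≤ (1 + η / 20) * L' := this.trans (by nlinarith)
    nlinarith
  have hRh : R / h ≤ (1 - η / 4) * (1 + η / 20) / ℓ := by
    rw [div_le_iff₀ hh]
    calc R ≤ h * (1 - η / 4) / L' := hR
      _ = (1 - η / 4) / L' * h := by ring
      _ ≤ (1 - η / 4) * (1 + η / 20) / ℓ * h := mul_le_mul_of_nonneg_right h1 hh.le
  have hsh : c₀ * H / h ≤ η / 20 / ℓ := by
    rw [div_le_div_iff₀ hh hℓ]; nlinarith
  have hkey : (R + c₀ * H) / h ≤ (1 - 3 * η / 20) / ℓ := by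
    rw [add_div]
    have : (1 - η / 4) * (1 + η / 20) / ℓ + η / 20 / ℓ ≤ (1 - 3 * η / 20) / ℓ := by
      rw [← add_div, div_le_div_iff_of_pos_right hℓ]; nlinarith
    linarith
  have h2 : cnt ≤ HdP * ((R + c₀ * H) / h) := by
    rw [mul_div_assoc', le_div_iff₀ hh]; linarith
  calc cnt ≤ HdP * ((R + c₀ * H) / h) := h2
    _ ≤ ((1 + η / 20) * Hd) * ((1 - 3 * η / 20) / ℓ) :=
        mul_le_mul hHdP hkey (by positivity) (by positivity)
    _ = Hd / ℓ * ((1 + η / 20) * (1 - 3 * η / 20)) := by ring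
    _ ≤ Hd / ℓ * (1 - η / 16) := mul_le_mul_of_nonneg_left (by nlinarith) (by positivity)
    _ = (1 - η / 16) * (Hd / ℓ) := by ring

/-! ## Corner geometry -/

/-- **The two scales fit into one range `[X, 2X]`.** Integer bookkeeping for the corners: with
the surplus row `m ∈ (N, 2N]`, the adapted scale `N' = ⌊7m/10⌋`, the deficit row `m' ∈ (N', 2N']`,
`q = ⌊(m+1)/c₀⌋`, `q' = ⌊(m'+1)/c₀⌋`, a spread `E ≥ 0` with `15c₀(E + 1) ≤ 2N`, and
`X = min(q, q') − E`: both `q + E` and `q' + E` are `≤ 2X`, `N ≤ 4c₀X`, `X ≤ 3N`, `X ≤ 3N'`,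
`X ≥ 0`. [folklore] -/
theorem corner_geometry {c₀ N m N' m' q₁ q₂ E : ℤ} (hc : 1 ≤ c₀) (hNm : N < m) (hm2N : m ≤ 2 * N)
    (hN'1 : 10 * N' ≤ 7 * m) (hN'2 : 7 * m < 10 * N' + 10) (hN'm' : N' < m') (hm'N' : m' ≤ 2 * N')
    (hq₁ : c₀ * q₁ ≤ m + 1) (hq₁' : m + 1 < c₀ * (q₁ + 1))
    (hq₂ : c₀ * q₂ ≤ m' + 1) (hq₂' : m' + 1 < c₀ * (q₂ + 1)) (hE : 0 ≤ E)
    (hG : 15 * c₀ * E + 15 * c₀ ≤ 2 * N) :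
    q₁ + E ≤ 2 * (min q₁ q₂ - E) ∧ q₂ + E ≤ 2 * (min q₁ q₂ - E) ∧
      N ≤ 4 * c₀ * (min q₁ q₂ - E) ∧ min q₁ q₂ - E ≤ 3 * N ∧ min q₁ q₂ - E ≤ 3 * N' ∧
      0 ≤ min q₁ q₂ - E := by
  have hc0 : 0 < c₀ := by omega
  have ha : c₀ * (q₁ + 3 * E) ≤ c₀ * (2 * q₂) := by nlinarith
  have hb : c₀ * (q₂ + 3 * E) ≤ c₀ * (2 * q₁) := by nlinarith
  have ha' : q₁ + 3 * E ≤ 2 * q₂ := le_of_mul_le_mul_left ha hc0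
  have hb' : q₂ + 3 * E ≤ 2 * q₁ := le_of_mul_le_mul_left hb hc0
  have hq1pos : 0 < q₁ := by
    by_contra h
    push Not at h
    have : c₀ * (q₁ + 1) ≤ c₀ * 1 := by nlinarith
    nlinarith
  have hq2pos : 0 < q₂ := by
    by_contra h
    push Not at h
    have : c₀ * (q₂ + 1) ≤ c₀ * 1 := by nlinarith
    nlinarith
  have h3 : c₀ * N ≤ c₀ * (4 * c₀ * (min q₁ q₂ - E)) := by
    rcases le_total q₁ q₂ with h | h
    · rw [min_eq_left h]; nlinarith
    · rw [min_eq_right h]; nlinarith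
  have hq1le : q₁ ≤ c₀ * q₁ := le_mul_of_one_le_left hq1pos.le hc
  have hq2le : q₂ ≤ c₀ * q₂ := le_mul_of_one_le_left hq2pos.le hc
  refine ⟨?_, ?_, le_of_mul_le_mul_left h3 hc0, ?_, ?_, ?_⟩
  · rcases le_total q₁ q₂ with h | h
    · rw [min_eq_left h]; linarith
    · rw [min_eq_right h]; linarith
  · rcases le_total q₁ q₂ with h | h
    · rw [min_eq_left h]; linarith
    · rw [min_eq_right h]; linarith
  · have := min_le_left q₁ q₂; linarith
  · have := min_le_right q₁ q₂; linarith
  · rcases le_total q₁ q₂ with h | h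
    · rw [min_eq_left h]; linarith
    · rw [min_eq_right h]; linarith

/-! ## The obstructed case -/

/-- **Local obstruction.** If a prime `p` divides every coefficient of the single form `ψ`
(`cⱼ ≥ 0`, `c ≠ 0`), then `∏_p β_p = 0` and `ψ(n)` is a proper multiple of `p` for every
`n ∈ [X, 2X]^d`, `X ≥ 2`: both inequalities of the fact hold trivially (with `δ± = 1`).
[cite: PandeyWoo2024, Theorem 5 (degenerate case `∏_p β_p = 0`)] -/
theorem irregularity_obstructed (Ψ : Fin 1 → AffLinForm d) (h0 : (Ψ 0).const = 0)
    (hc : ∀ j, 0 ≤ (Ψ 0).coeff j) (hne : (Ψ 0).coeff ≠ 0) {p : ℕ} (hp : p.Prime)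
    (hall : ∀ j, (p : ℤ) ∣ (Ψ 0).coeff j) (lam : ℝ) (X₀ : ℕ) :
    ∃ X : ℕ, X₀ ≤ X ∧
      (∃ x : Fin d → ℕ, (∀ j, X ≤ x j ∧ x j ≤ 2 * X) ∧
        (1 + 1) * smallScaleMainTerm Ψ lam X ≤ primePatternCount Ψ x ((Real.log X) ^ lam)) ∧
      (∃ x : Fin d → ℕ, (∀ j, X ≤ x j ∧ x j ≤ 2 * X) ∧
        (primePatternCount Ψ x ((Real.log X) ^ lam) : ℝ) ≤ (1 - 1) * smallScaleMainTerm Ψ lam X) := by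
  classical
  have hS : singularProduct Ψ = 0 := singularProduct_eq_zero Ψ h0 hp hall
  have hM : ∀ X : ℕ, smallScaleMainTerm Ψ lam X = 0 := fun X => by
    unfold smallScaleMainTerm; rw [hS, mul_zero]
  set X : ℕ := max X₀ 2 with hX
  have hX2 : 2 ≤ X := le_max_right _ _
  have hcount : primePatternCount Ψ (fun _ => X) ((Real.log X) ^ lam) = 0 := by
    rw [primePatternCount_fin_one, Finset.card_eq_zero, filter_eq_empty_iff]
    intro n hn
    have hnX : ∀ j, (X : ℤ) ≤ n j := fun j => (mem_Icc.1 (Fintype.mem_piFinset.1 hn j)).1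
    obtain ⟨j₁, hj₁⟩ : ∃ j, (Ψ 0).coeff j ≠ 0 := by
      by_contra h
      push Not at h
      exact hne (funext h)
    have hcj : (p : ℤ) ≤ (Ψ 0).coeff j₁ :=
      Int.le_of_dvd (lt_of_le_of_ne (hc j₁) (Ne.symm hj₁)) (hall j₁)
    have hn0 : ∀ j, 0 ≤ n j := fun j => le_trans (by positivity) (hnX j)
    have h2 : (2 : ℤ) ≤ n j₁ := le_trans (by exact_mod_cast hX2) (hnX j₁)
    have hψ : (p : ℤ) * 2 ≤ (Ψ 0).eval n :=
      le_trans (mul_le_mul hcj h2 (by norm_num) (hc j₁)) (coeff_mul_le_eval _ h0 hc hn0 j₁)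
    have hdvd : (p : ℤ) ∣ (Ψ 0).eval n := by
      rw [eval_eq_sum _ h0]
      exact dvd_sum fun j _ => dvd_mul_of_dvd_left (hall j) _
    intro hprime
    have hMeq : ((((Ψ 0).eval n).toNat : ℕ) : ℤ) = (Ψ 0).eval n := Int.toNat_of_nonneg (by linarith)
    have hpM : p ∣ ((Ψ 0).eval n).toNat := by
      rw [← Int.natCast_dvd_natCast, hMeq]; exact hdvd
    rcases (Nat.dvd_prime hprime).1 hpM with h1 | h1
    · exact hp.one_lt.ne' h1
    · have : ((p : ℕ) : ℤ) = (Ψ 0).eval n := by rw [h1, hMeq]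
      have hp0 : (0 : ℤ) < p := by exact_mod_cast hp.pos
      linarith
  refine ⟨X, le_max_left _ _, ⟨fun _ => X, fun _ => ⟨le_rfl, Nat.le_mul_of_pos_left X two_pos⟩, ?_⟩,
    ⟨fun _ => X, fun _ => ⟨le_rfl, Nat.le_mul_of_pos_left X two_pos⟩, ?_⟩⟩
  · rw [hM, mul_zero]; exact Nat.cast_nonneg _
  · rw [hM, mul_zero, hcount, Nat.cast_zero]

end SingleForm

end Literature.Barriers.Parity
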